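import Mathlib.Data.ZMod.Basic
import Mathlib.Analysis.SumIntegralComparisons
import Mathlib.Analysis.SpecialFunctions.Integrals.Basic
import Mathlib.NumberTheory.ArithmeticFunction.Moebius
import Mathlib.Analysis.SpecialFunctions.Pow.NNReal
import Mathlib.Analysis.SpecialFunctions.Exp
import Mathlib.Tactic.Ring
import Mathlib.RingTheory.Coprime.Lemmas
import HarnessLib

/-!
# The enveloping sieve: moment bounds for the correlation weight `τ` (Green–Tao 2010, App. D)

Trunk T-SIEVE (`Literature/NumberTheory/Sieve`). Third file of the App. D layer of the
decomposition of `Literature.NumberTheory.Sieve.GreenTaoZiegler2012_finiteComplexity` (towards Prop. 6.4 of B. Green,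
T. Tao, *Linear equations in primes*, Ann. of Math. 171 (2010)). The correlation condition for the
enveloping sieve (App. D, p. 48 of arXiv:math/0606088) uses the weight
`τ(n) = ∑_{j<j'} exp(O(∑_{p > w, p | Wn + b_{i_j} - b_{i_{j'}}} p^{-1/2}))` and requires the moment
bounds `𝔼_{n ∈ [N]} τ(n)^q ≪_q 1`, which the source reduces to
`𝔼_{n ∈ [N]} exp(q ∑_{p > w, p | Wn+h} p^{-1/2}) ≪_q 1` and then to
`∑_{n ∈ [N]} ∏_{p > w, p | Wn+h} (1 + p^{-1/4}) ≪ N`, proved via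
`∏_{p>w, p|Wn+h}(1 + p^{-1/4}) ≤ ∑_{(d,W)=1, d | Wn+h} d^{-1/4}` and
`∑_{n ∈ [N], d | Wn+h} 1 = O(1 + N/d)` ("by the Chinese remainder theorem"). This file proves
all of this with explicit constants:

* `Literature.NumberTheory.Sieve.card_filter_dvd_affine_le` — `#{n ∈ [N] : d | Wn + h} ≤ N/d + 1` for `(d, W) = 1`;
* `Literature.roughWeight w m = ∏_{p > w, p | m} (1 + p^{-1/4})`, its expansion over rough squarefree
  divisors (`Literature.NumberTheory.Sieve.roughWeight_eq_sum`) and `Literature.NumberTheory.Sieve.sum_roughWeight_le_linear`: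
  `∑_{n ∈ [N]} roughWeight w (Wn+h) ≤ 5N + (4/3)(WN+h)^{3/4}` when all prime factors of `W` are `≤ w`
  (integral comparison for `∑ d^{-5/4}` and `∑ d^{-1/4}`);
* `Literature.NumberTheory.Sieve.exp_sum_le_roughWeight` — `exp(q ∑_{p>w, p|m} p^{-1/2}) ≤ roughWeight w m` for `w ≥ (2q)^4`,
  and the resulting moment bound `Literature.NumberTheory.Sieve.sum_exp_rough_le`.

## References

* B. Green, T. Tao, *Linear equations in primes*, Ann. of Math. (2) 171 (2010), 1753–1850
  (arXiv:math/0606088), App. D, end of the proof of Prop. 6.4 (the displays from "To show the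
  moment bounds on `τ`" to "the claim then follows easily").
-/

noncomputable section

namespace Literature.NumberTheory.Sieve

/-- **Divisibility along a `W`-progression** ("by the Chinese remainder theorem"): for `d` coprime to
`W`, the `n ∈ [N]` with `d ∣ W n + h` lie in a single residue class modulo `d`, so there are at most
`N/d + 1` of them. [cite: GreenTao2010, App. D (end of the proof of Prop. 6.4: "`∑_{n ∈ [N], d | Wn+h} 1 = O(1 + N/d)` by the Chinese remainder theorem")] -/
theorem card_filter_dvd_affine_le {d W : ℕ} (hcop : Nat.Coprime d W) (h : ℤ) (N : ℕ) :
    ((Finset.Icc 1 N).filter fun n : ℕ => (d : ℤ) ∣ (W : ℤ) * n + h).card ≤ N / d + 1 := by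
  classical
  set S := (Finset.Icc 1 N).filter fun n : ℕ => (d : ℤ) ∣ (W : ℤ) * n + h with hS
  -- any two elements are congruent mod `d`
  have hcong : ∀ n ∈ S, ∀ n' ∈ S, n % d = n' % d := by
    intro n hn n' hn'
    have h1 := (Finset.mem_filter.mp hn).2
    have h2 := (Finset.mem_filter.mp hn').2
    have h3 : (d : ℤ) ∣ (W : ℤ) * ((n : ℤ) - n') := by
      have := dvd_sub h1 h2
      have e : (W : ℤ) * n + h - ((W : ℤ) * n' + h) = (W : ℤ) * ((n : ℤ) - n') := by ring
      rwa [e] at this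
    have h4 : (d : ℤ) ∣ (n : ℤ) - n' := by
      have hc : IsCoprime (d : ℤ) (W : ℤ) := Nat.isCoprime_iff_coprime.mpr hcop
      exact hc.dvd_of_dvd_mul_left h3
    have h5 : n' ≡ n [MOD d] := Nat.modEq_iff_dvd.mpr h4
    exact h5.symm
  -- hence `n ↦ n / d` is injective on `S`, with values `≤ N / d`
  have hinj : Set.InjOn (fun n : ℕ => n / d) S := by
    intro n hn n' hn' hq
    have e1 := Nat.div_add_mod n d
    have e2 := Nat.div_add_mod n' d
    simp only at hq
    rw [← e1, ← e2, hq, hcong n hn n' hn']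
  have hmaps : Set.MapsTo (fun n : ℕ => n / d) S (Finset.range (N / d + 1)) := by
    intro n hn
    have hnN : n ≤ N := (Finset.mem_Icc.mp (Finset.mem_filter.mp hn).1).2
    exact Finset.mem_coe.mpr (Finset.mem_range.mpr (Nat.lt_succ_of_le (Nat.div_le_div_right hnN)))
  have := Finset.card_le_card_of_injOn (fun n : ℕ => n / d) hmaps hinj
  rwa [Finset.card_range] at this

/-- `x ↦ x^{-r}` is antitone on `[1, ∞)` for `r ≥ 0`. [folklore] -/
theorem antitoneOn_rpow_neg {r : ℝ} (hr : 0 ≤ r) (b : ℝ) :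
    AntitoneOn (fun x : ℝ => x ^ (-r)) (Set.Icc (1 : ℝ) b) := fun x hx y _ hxy =>
  Real.rpow_le_rpow_of_nonpos (by linarith [hx.1]) hxy (by linarith)

/-- `∑_{2 ≤ d ≤ a+1} d^{-1/4} ≤ (4/3)((a+1)^{3/4} - 1)` (integral comparison on `[1, a+1]`). [folklore] -/
theorem sum_rpow_neg_quarter_le (a : ℕ) :
    ∑ i ∈ Finset.range a, ((i + 2 : ℕ) : ℝ) ^ (-(1 / 4 : ℝ)) ≤
      4 / 3 * (((a : ℝ) + 1) ^ (3 / 4 : ℝ) - 1) := by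
  have h := AntitoneOn.sum_le_integral (x₀ := 1) (a := a) (antitoneOn_rpow_neg (r := 1 / 4) (by norm_num) _)
  have e : ∀ i : ℕ, (1 : ℝ) + ((i + 1 : ℕ) : ℝ) = ((i + 2 : ℕ) : ℝ) := fun i => by push_cast; ring
  simp only [e] at h
  refine h.trans ?_
  rw [integral_rpow (Or.inl (by norm_num)), Real.one_rpow]
  have : (-(1 / 4 : ℝ) + 1) = 3 / 4 := by norm_num
  rw [this, add_comm (1 : ℝ) a]
  rw [div_eq_mul_inv, mul_comm]
  norm_num

/-- `∑_{2 ≤ d ≤ a+1} d^{-5/4} ≤ 4` (integral comparison on `[1, a+1]`). [folklore] -/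
theorem sum_rpow_neg_five_quarters_le (a : ℕ) :
    ∑ i ∈ Finset.range a, ((i + 2 : ℕ) : ℝ) ^ (-(5 / 4 : ℝ)) ≤ 4 := by
  have h := AntitoneOn.sum_le_integral (x₀ := 1) (a := a) (antitoneOn_rpow_neg (r := 5 / 4) (by norm_num) _)
  have e : ∀ i : ℕ, (1 : ℝ) + ((i + 1 : ℕ) : ℝ) = ((i + 2 : ℕ) : ℝ) := fun i => by push_cast; ring
  simp only [e] at h
  refine h.trans ?_
  have h1 : (0 : ℝ) ∉ Set.uIcc (1 : ℝ) (1 + a) := by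
    rw [Set.uIcc_of_le (by linarith [(Nat.cast_nonneg a : (0:ℝ) ≤ a)])]
    intro h0; exact absurd h0.1 (by norm_num)
  rw [integral_rpow (Or.inr ⟨by norm_num, h1⟩), Real.one_rpow]
  have : (-(5 / 4 : ℝ) + 1) = -(1 / 4) := by norm_num
  rw [this]
  have hpos : (0 : ℝ) ≤ (1 + (a : ℝ)) ^ (-(1 / 4 : ℝ)) := Real.rpow_nonneg (by positivity) _
  rw [div_le_iff_of_neg (by norm_num : (-(1/4 : ℝ)) < 0)]
  linarith

/-- The `w`-rough prime factors of `m`. [folklore] -/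
def roughPrimeFactors (w m : ℕ) : Finset ℕ := m.primeFactors.filter fun p => w < p

/-- The arithmetic weight `∏_{p > w, p | m} (1 + p^{-1/4})`. [cite: GreenTao2010, App. D (end of
the proof of Prop. 6.4)] -/
def roughWeight (w m : ℕ) : ℝ := ∏ p ∈ roughPrimeFactors w m, (1 + (p : ℝ) ^ (-(1 / 4 : ℝ)))

/-- **Expanding the weight over squarefree divisors**:
`∏_{p > w, p | m} (1 + p^{-1/4}) = ∑_{T ⊆ P_w(m)} (∏_{p ∈ T} p)^{-1/4}`.
[cite: GreenTao2010, App. D ("`∏_{p>w, p|Wn+h} (1 + p^{-1/4}) ≤ ∑_{(d,W)=1, d|Wn+h} d^{-1/4}`")] -/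
theorem roughWeight_eq_sum (w m : ℕ) :
    roughWeight w m = ∑ T ∈ (roughPrimeFactors w m).powerset, (((∏ p ∈ T, p : ℕ)) : ℝ) ^ (-(1 / 4 : ℝ)) := by
  classical
  unfold roughWeight
  have : ∀ p ∈ roughPrimeFactors w m, (1 + (p : ℝ) ^ (-(1 / 4 : ℝ))) = ((p : ℝ) ^ (-(1 / 4 : ℝ)) + 1) :=
    fun p _ => add_comm _ _
  rw [Finset.prod_congr rfl this, Finset.prod_add]
  refine Finset.sum_congr rfl fun T _ => ?_
  rw [Finset.prod_const_one, mul_one, Nat.cast_prod,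
    Real.finsetProd_rpow _ _ (fun p _ => Nat.cast_nonneg p)]

/-- Elements of the powerset of the rough prime factors give distinct squarefree divisors. [folklore] -/
theorem prod_injOn_powerset_roughPrimeFactors (w m : ℕ) :
    Set.InjOn (fun T : Finset ℕ => ∏ p ∈ T, p) ((roughPrimeFactors w m).powerset : Set (Finset ℕ)) := by
  intro T hT T' hT' h
  have hp : ∀ T ∈ ((roughPrimeFactors w m).powerset : Set (Finset ℕ)), ∀ p ∈ T, p.Prime := by
    intro T hT p hp
    have := Finset.mem_powerset.mp (Finset.mem_coe.mp hT) hp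
    exact Nat.prime_of_mem_primeFactors (Finset.mem_filter.mp this).1
  have e1 := Nat.primeFactors_prod (hp T hT)
  have e2 := Nat.primeFactors_prod (hp T' hT')
  simp only at h
  rw [← e1, ← e2, h]

/-- **The divisor-sum bound for the weight along a `W`-progression**:
`∑_{n ∈ [N]} ∏_{p > w, p | Wn+h} (1 + p^{-1/4}) ≤ ∑_{d ≤ WN+h, d | Wn+h for some n, p | d ⇒ p > w} d^{-1/4} #{n ∈ [N] : d | Wn + h}`,
in the convenient form with `d` ranging over all of `[1, WN + h]` restricted to `w`-rough `d`.
[cite: GreenTao2010, App. D (end of the proof of Prop. 6.4)] -/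
theorem sum_roughWeight_le (w W h N : ℕ) (hW : 1 ≤ W) :
    ∑ n ∈ Finset.Icc 1 N, roughWeight w (W * n + h) ≤
      ∑ d ∈ (Finset.Icc 1 (W * N + h)).filter (fun d => ∀ p ∈ d.primeFactors, w < p),
        (d : ℝ) ^ (-(1 / 4 : ℝ)) *
          (((Finset.Icc 1 N).filter fun n : ℕ => (d : ℤ) ∣ (W : ℤ) * n + h).card : ℝ) := by
  classical
  set D := (Finset.Icc 1 (W * N + h)).filter (fun d => ∀ p ∈ d.primeFactors, w < p) with hD
  -- Step 1: pointwise, the weight is a sum over rough divisors `d ∈ D` of `W n + h`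
  have hpt : ∀ n ∈ Finset.Icc 1 N, roughWeight w (W * n + h) ≤
      ∑ d ∈ D, if (d : ℤ) ∣ (W : ℤ) * n + h then (d : ℝ) ^ (-(1 / 4 : ℝ)) else 0 := by
    intro n hn
    have hn1 : 1 ≤ n := (Finset.mem_Icc.mp hn).1
    have hnN : n ≤ N := (Finset.mem_Icc.mp hn).2
    have hm : 0 < W * n + h := by positivity
    rw [roughWeight_eq_sum]
    have himg := Finset.sum_image (f := fun d : ℕ => (d : ℝ) ^ (-(1 / 4 : ℝ)))
      (prod_injOn_powerset_roughPrimeFactors w (W * n + h))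
    rw [← himg, ← Finset.sum_filter]
    refine Finset.sum_le_sum_of_subset_of_nonneg ?_ (fun d _ _ => Real.rpow_nonneg (Nat.cast_nonneg d) _)
    intro d hd
    obtain ⟨T, hT, rfl⟩ := Finset.mem_image.mp hd
    have hTsub := Finset.mem_powerset.mp hT
    have hprime : ∀ p ∈ T, p.Prime := fun p hp =>
      Nat.prime_of_mem_primeFactors (Finset.mem_filter.mp (hTsub hp)).1
    have hdvd : (∏ p ∈ T, p) ∣ W * n + h := by
      refine Finset.prod_primes_dvd _ (fun p hp => (hprime p hp).prime) fun p hp => ?_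
      exact Nat.dvd_of_mem_primeFactors (Finset.mem_filter.mp (hTsub hp)).1
    refine Finset.mem_filter.mpr ⟨Finset.mem_filter.mpr ⟨Finset.mem_Icc.mpr ⟨?_, ?_⟩, ?_⟩, ?_⟩
    · exact Finset.prod_pos fun p hp => (hprime p hp).pos
    · exact (Nat.le_of_dvd hm hdvd).trans (by nlinarith)
    · intro p hp
      rw [Nat.primeFactors_prod hprime] at hp
      exact (Finset.mem_filter.mp (hTsub hp)).2
    · exact_mod_cast (Int.natCast_dvd_natCast.mpr hdvd : ((∏ p ∈ T, p : ℕ) : ℤ) ∣ ((W * n + h : ℕ) : ℤ))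
  refine (Finset.sum_le_sum hpt).trans ?_
  rw [Finset.sum_comm]
  refine Finset.sum_le_sum fun d _ => ?_
  rw [← Finset.sum_filter, Finset.sum_const, nsmul_eq_mul, mul_comm]

/-- Reindexing `∑_{d=1}^{M}` as `f 1 + ∑_{i < M-1} f (i+2)`. [folklore] -/
theorem sum_Icc_one_eq (M : ℕ) (hM : 1 ≤ M) (f : ℕ → ℝ) :
    ∑ d ∈ Finset.Icc 1 M, f d = f 1 + ∑ i ∈ Finset.range (M - 1), f (i + 2) := by
  obtain ⟨M', rfl⟩ : ∃ M', M = M' + 1 := ⟨M - 1, by omega⟩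
  rw [show Finset.Icc 1 (M' + 1) = Finset.Ico 1 (M' + 1 + 1) from rfl, Finset.sum_Ico_eq_sum_range]
  rw [show M' + 1 + 1 - 1 = M' + 1 by omega, Finset.sum_range_succ', Nat.add_sub_cancel]
  rw [add_comm]
  congr 1
  exact Finset.sum_congr rfl fun i _ => by congr 1; omega

/-- `∑_{d=1}^{M} d^{-5/4} ≤ 5`. [folklore] -/
theorem sum_Icc_rpow_neg_five_quarters_le (M : ℕ) :
    ∑ d ∈ Finset.Icc 1 M, (d : ℝ) ^ (-(5 / 4 : ℝ)) ≤ 5 := by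
  rcases Nat.eq_zero_or_pos M with rfl | hM
  · simp
  rw [sum_Icc_one_eq M hM]
  push_cast
  rw [Real.one_rpow]
  have := sum_rpow_neg_five_quarters_le (M - 1)
  push_cast at this
  linarith

/-- `∑_{d=1}^{M} d^{-1/4} ≤ (4/3) M^{3/4}` for `M ≥ 1`. [folklore] -/
theorem sum_Icc_rpow_neg_quarter_le (M : ℕ) (hM : 1 ≤ M) :
    ∑ d ∈ Finset.Icc 1 M, (d : ℝ) ^ (-(1 / 4 : ℝ)) ≤ 4 / 3 * (M : ℝ) ^ (3 / 4 : ℝ) := by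
  rw [sum_Icc_one_eq M hM]
  push_cast
  rw [Real.one_rpow]
  have h := sum_rpow_neg_quarter_le (M - 1)
  push_cast at h
  have e : ((M - 1 : ℕ) : ℝ) + 1 = M := by
    rw [Nat.cast_sub hM]; push_cast; ring
  rw [e] at h
  have h1 : (1 : ℝ) ≤ (M : ℝ) ^ (3 / 4 : ℝ) := Real.one_le_rpow (by exact_mod_cast hM) (by norm_num)
  linarith

/-- **The divisor-sum bound, evaluated**: if every prime factor of `W` is `≤ w` then
`∑_{n ∈ [N]} ∏_{p > w, p | Wn+h} (1 + p^{-1/4}) ≤ 5N + (4/3)(WN + h)^{3/4}`.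
[cite: GreenTao2010, App. D (end of the proof of Prop. 6.4: "`∑_{n∈[N]} ∏_{p>w, p|Wn+h}(1+p^{-1/4}) ≪_q N`")] -/
theorem sum_roughWeight_le_linear (w W h N : ℕ) (hW : 1 ≤ W) (hN : 1 ≤ N)
    (hWw : ∀ p, p.Prime → p ∣ W → p ≤ w) :
    ∑ n ∈ Finset.Icc 1 N, roughWeight w (W * n + h) ≤
      5 * N + 4 / 3 * ((W * N + h : ℕ) : ℝ) ^ (3 / 4 : ℝ) := by
  classical
  refine (sum_roughWeight_le w W h N hW).trans ?_
  set M := W * N + h with hMdef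
  have hM1 : 1 ≤ M := by rw [hMdef]; nlinarith
  -- each term: `d^{-1/4} #{…} ≤ N d^{-5/4} + d^{-1/4}`
  have hterm : ∀ d ∈ (Finset.Icc 1 M).filter (fun d => ∀ p ∈ d.primeFactors, w < p),
      (d : ℝ) ^ (-(1 / 4 : ℝ)) *
        (((Finset.Icc 1 N).filter fun n : ℕ => (d : ℤ) ∣ (W : ℤ) * n + h).card : ℝ) ≤
      (N : ℝ) * (d : ℝ) ^ (-(5 / 4 : ℝ)) + (d : ℝ) ^ (-(1 / 4 : ℝ)) := by
    intro d hd
    obtain ⟨hdI, hrough⟩ := Finset.mem_filter.mp hd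
    have hd1 : 1 ≤ d := (Finset.mem_Icc.mp hdI).1
    have hd0 : (0 : ℝ) < d := by exact_mod_cast hd1
    have hcop : Nat.Coprime d W := by
      refine Nat.coprime_of_dvd fun k hk hkd hkW => ?_
      have h1 : w < k := hrough k (Nat.mem_primeFactors.mpr ⟨hk, hkd, by omega⟩)
      have h2 := hWw k hk hkW
      omega
    have hcard := card_filter_dvd_affine_le hcop (h : ℤ) N
    have hcardR : (((Finset.Icc 1 N).filter fun n : ℕ => (d : ℤ) ∣ (W : ℤ) * n + h).card : ℝ) ≤
        (N : ℝ) / d + 1 := by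
      have h1 : (((Finset.Icc 1 N).filter fun n : ℕ => (d : ℤ) ∣ (W : ℤ) * n + h).card : ℝ) ≤
          ((N / d + 1 : ℕ) : ℝ) := by exact_mod_cast hcard
      refine h1.trans ?_
      push_cast
      linarith [(Nat.cast_div_le (m := N) (n := d) : ((N / d : ℕ) : ℝ) ≤ N / d)]
    have hsplit : (d : ℝ) ^ (-(1 / 4 : ℝ)) * ((N : ℝ) / d + 1) =
        (N : ℝ) * (d : ℝ) ^ (-(5 / 4 : ℝ)) + (d : ℝ) ^ (-(1 / 4 : ℝ)) := by
      have e : (d : ℝ) ^ (-(5 / 4 : ℝ)) = (d : ℝ) ^ (-(1 / 4 : ℝ)) * (d : ℝ)⁻¹ := by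
        rw [← Real.rpow_neg_one, ← Real.rpow_add hd0]; norm_num
      rw [e]; field_simp
    calc (d : ℝ) ^ (-(1 / 4 : ℝ)) *
          (((Finset.Icc 1 N).filter fun n : ℕ => (d : ℤ) ∣ (W : ℤ) * n + h).card : ℝ)
        ≤ (d : ℝ) ^ (-(1 / 4 : ℝ)) * ((N : ℝ) / d + 1) :=
          mul_le_mul_of_nonneg_left hcardR (Real.rpow_nonneg hd0.le _)
      _ = _ := hsplit
  refine (Finset.sum_le_sum hterm).trans ?_
  refine (Finset.sum_le_sum_of_subset_of_nonneg (Finset.filter_subset _ _) fun d _ _ => by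
    positivity).trans ?_
  rw [Finset.sum_add_distrib, ← Finset.mul_sum]
  have h1 := sum_Icc_rpow_neg_five_quarters_le M
  have h2 := sum_Icc_rpow_neg_quarter_le M hM1
  have hN0 : (0 : ℝ) ≤ N := Nat.cast_nonneg N
  nlinarith [mul_le_mul_of_nonneg_left h1 hN0]

/-- `exp x ≤ 1 + 2x` for `0 ≤ x ≤ 1`. [folklore] -/
theorem exp_le_one_add_two_mul {x : ℝ} (h0 : 0 ≤ x) (h1 : x ≤ 1) : Real.exp x ≤ 1 + 2 * x := by
  have h := Real.abs_exp_sub_one_sub_id_le (abs_le.mpr ⟨by linarith, h1⟩)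
  have h2 : x ^ 2 ≤ x := by nlinarith
  linarith [(abs_le.mp h).2]

/-- **Exponential of `p^{-1/2}` versus `1 + p^{-1/4}`**: `exp(q p^{-1/2}) ≤ 1 + p^{-1/4}` for
`p ≥ (2q)^4` ("by repeating the proof of [GT08] we can deduce this bound from …").
[cite: GreenTao2010, App. D (end of the proof of Prop. 6.4)] -/
theorem exp_mul_rpow_le {q : ℝ} (hq : 0 ≤ q) {p : ℕ} (hp1 : 1 ≤ p) (hp : (2 * q) ^ 4 ≤ p) :
    Real.exp (q * (p : ℝ) ^ (-(1 / 2 : ℝ))) ≤ 1 + (p : ℝ) ^ (-(1 / 4 : ℝ)) := by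
  have hp0 : (0 : ℝ) < p := by exact_mod_cast hp1
  set u : ℝ := (p : ℝ) ^ (-(1 / 4 : ℝ)) with hu
  have hu0 : 0 < u := Real.rpow_pos_of_pos hp0 _
  have hu1 : u ≤ 1 := Real.rpow_le_one_of_one_le_of_nonpos (by exact_mod_cast hp1) (by norm_num)
  have husq : (p : ℝ) ^ (-(1 / 2 : ℝ)) = u ^ 2 := by
    rw [hu, ← Real.rpow_natCast, ← Real.rpow_mul hp0.le]; norm_num
  -- `2 q u ≤ 1`: from `(2q)^4 ≤ p`, i.e. `2q ≤ p^{1/4} = u⁻¹`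
  have h2q : 2 * q * u ≤ 1 := by
    have h4 : (2 * q) ^ 4 ≤ (p : ℝ) := by exact_mod_cast hp
    have hroot : 2 * q ≤ (p : ℝ) ^ (1 / 4 : ℝ) := by
      have := Real.rpow_le_rpow (by positivity) h4 (by norm_num : (0 : ℝ) ≤ 1 / 4)
      rwa [← Real.rpow_natCast, ← Real.rpow_mul (by positivity), show ((4 : ℕ) : ℝ) * (1 / 4) = 1 by norm_num,
        Real.rpow_one] at this
    have hinv : (p : ℝ) ^ (1 / 4 : ℝ) * u = 1 := by
      rw [hu, ← Real.rpow_add hp0]; norm_num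
    nlinarith [hu0]
  rw [husq]
  have hx1 : q * u ^ 2 ≤ 1 := by nlinarith
  calc Real.exp (q * u ^ 2) ≤ 1 + 2 * (q * u ^ 2) := exp_le_one_add_two_mul (by positivity) hx1
    _ = 1 + (2 * q * u) * u := by ring
    _ ≤ 1 + 1 * u := by nlinarith
    _ = 1 + u := by ring

/-- **The exponential weight is dominated by the rough weight**:
`exp(q ∑_{p > w, p | m} p^{-1/2}) ≤ ∏_{p > w, p | m} (1 + p^{-1/4})` for `w ≥ (2q)^4`.
[cite: GreenTao2010, App. D (end of the proof of Prop. 6.4)] -/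
theorem exp_sum_le_roughWeight {q : ℝ} (hq : 0 ≤ q) {w : ℕ} (hw : (2 * q) ^ 4 ≤ w) (m : ℕ) :
    Real.exp (q * ∑ p ∈ roughPrimeFactors w m, (p : ℝ) ^ (-(1 / 2 : ℝ))) ≤ roughWeight w m := by
  unfold roughWeight
  rw [Finset.mul_sum, Real.exp_sum]
  refine Finset.prod_le_prod (fun p _ => (Real.exp_pos _).le) fun p hp => ?_
  have hwp : w < p := (Finset.mem_filter.mp hp).2
  have hprime : p.Prime := Nat.prime_of_mem_primeFactors (Finset.mem_filter.mp hp).1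
  exact exp_mul_rpow_le hq hprime.one_lt.le (hw.trans (by exact_mod_cast hwp.le))

/-- **Moment bound for the arithmetic weight `τ`** (Green–Tao 2010, App. D, the last step of the
proof of Prop. 6.4, as printed: "To show the moment bounds on `τ` it suffices to show that
`𝔼_{n ∈ [N]} exp(q ∑_{p>w, p | Wn+h} p^{-1/2}) ≪_q 1` for all `h = O(W)`"; here with the explicit
bound `5N + (4/3)(WN+h)^{3/4}` for the sum, valid for `w ≥ (2q)^4` and `W` all of whose prime
factors are `≤ w`). [cite: GreenTao2010, App. D (end of the proof of Prop. 6.4)] -/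
theorem sum_exp_rough_le {q : ℝ} (hq : 0 ≤ q) {w W h N : ℕ} (hw : (2 * q) ^ 4 ≤ w) (hW : 1 ≤ W)
    (hN : 1 ≤ N) (hWw : ∀ p, p.Prime → p ∣ W → p ≤ w) :
    ∑ n ∈ Finset.Icc 1 N, Real.exp (q * ∑ p ∈ roughPrimeFactors w (W * n + h), (p : ℝ) ^ (-(1 / 2 : ℝ))) ≤
      5 * N + 4 / 3 * ((W * N + h : ℕ) : ℝ) ^ (3 / 4 : ℝ) :=
  (Finset.sum_le_sum fun _ _ => exp_sum_le_roughWeight hq hw _).trans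
    (sum_roughWeight_le_linear w W h N hW hN hWw)

end Literature.NumberTheory.Sieve

end
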